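import Summits.KontsevichZagierPeriods.Zeta5Search.WellPoisedFaceOddGrowthFree
import HarnessLib.Audit
import HarnessLib

/-!
# The INTERIOR of Zudilin's very-well-poised odd-zeta boxes (`r = 3`, any `q = M + 5 ≥ 6`):
# Lemma 19's normalisation with the pairs switched on, typed verbatim, and the CONDITIONAL REDUCTION
# "`C₀ + φ < δ` (equivalently `κ = C₀/(δ − φ) < 1`) ⟹ the normalised linear forms do not tend to `0`"
# — cell `pub-zeta5`, class `odd` (gen 57), SCOREBOARD §E column "no-go theorem" (interior rows odd-2/3/4)

HONEST FRAMING: systematic search; no irrationality claim unless certified.  This file proves a NEGATIVE-shaped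
REDUCTION (a conditional no-go), not a candidate: nothing here says anything about `ζ(5)`, `ζ(7)`, `ζ(9)`.

## What is typed (all VERBATIM from [Zudilin2004] = W. Zudilin, *Arithmetic of linear forms involving odd zeta
values*, J. Théor. Nombres Bordeaux 16 (2004) 251–291 = arXiv:math/0206176, §8)
For an INTEGRAL direction `(η₀; η₁ ≤ η₂ ≤ η₃ ≤ η₄ ≤ … ≤ η_q)` of the `r = 3`, `q = M + 5` box (`IntDir M`: the
tree's face directions `IntFaceDir M` — tails `η₄ … η_q`, `2η_q < η₀` — plus three HEADS `η₁, η₂, η₃ ≤ η₄`; the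
numerator-free face of the tree files is `head = 0`, `IntDir.ofFace`), along the ray `h₀ = η₀n + 2`,
`h_j = η_j n + 1`:
* `intMZ` = Lemma 19's `M_j = max{h₃ − 1, h₀ − 2h₄, h₀ − h₁ − h_{3+j}}` = the tree's `mLast` with the heads in
  place; DICTIONARY `intMZ_eq : M_j = μ(η_{3+j})·n`, `μ(x) = max{η₃, η₀ − 2η₄, η₀ − η₁ − x}` (`IntDir.imu`);
* `intPhi` = (8.9) `Φ(h) = ∏_{√h₀ < p ≤ M_q} p^{ν_p}` = the tree's `PhiQ` (pair summands `pairTerm` for `h₁,h₂,h₃`,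
  brick summands for the tails, `k`-range from `h₄`; `PhiQ` was typed for arbitrary heads and ANY number of
  bricks in `WellPoisedFaceAliveBricks`, p244474) — here merely INSTANTIATED with `h_j = η_j n + 1`;
* `intD = D_{M₁}³ · ∏_{j ≥ 2} D_{M_j}` (`D_N = lcm(1..N) = Nat.lcmUpto N`), `intDeltaN = 3μ(η₄) + Σ_{j>4} μ(η_j)`
  and `tendsto_log_intD_div : (log D(n))/n → δ` (PNT for `ψ`, the tree's `ViolaZudilin.tendsto_log_lcmUpto_mul_div`);
* `intR` = the summand (8.5)/(8.7): the three PAIR factors `(t+1)_{h_j−1}(t+h₀−h_j+1)_{h_j−1}/((h_j−1)!)²`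
  (`pairFactor`, `= 1` at `η_j = 0`) times the tree's tail summand `WellPoisedFaceRate.tailR` (p246813);
  `intF = ½ Σ_{t ≥ 0} R″(t)` = (8.6); `intLambda n = Λ_n := D(n) · Φ(h_n)⁻¹ · F(h_n)` = Lemma 19's normalised form.
## What is proved (kernel, standard axioms)
* `intLambda_frequently_ge` / **`interior_noGo`**: IF `(i)` for every `C > C₀`, `|F(h_n)| ≥ e^{−Cn}` for
  infinitely many `n` (this is `limsup (1/n) log |F(h_n)| ≥ −C₀`, the lower half of [Zudilin2004, Lemma 20]),
  `(ii)` for every `φ' > φ`, `log Φ(h_n) ≤ φ'n` eventually (this is `limsup (1/n) log Φ(h_n) ≤ φ`, (8.10)), and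
  `(iii)` `C₀ + φ < δ` (⟺ `κ := C₀/(δ − φ) < 1`, `interior_noGo_kappa`), THEN `|Λ_n| ≥ e^{εn} ≥ 1` for infinitely
  many `n`; in particular `Λ_n ↛ 0`, so Nesterenko's criterion / [Zudilin2004, Proposition 5] has nothing to work
  with at that direction.  `(i)` and `(ii)` are PRINTED asymptotics entering ONLY as hypotheses (no printed fact is
  an axiom); `(iii)` is the inequality the lane's certified-MODEL box scans evaluate direction by direction
  (SUPKAPPA.md: `max κ = 0.5960152073` on the `q = 9` box, `0.8581518058` on the `q = 11` box, ARB-certified at the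
  maximisers; extension to every lattice direction of height `≤ B` requested as `zeta5-odd-interior40`).
* CONSISTENCY WITH THE FACE (`§5`): at `head = 0` every object above IS the corresponding tree object
  (`intLambda_ofFace : Λ = faceLambda faceForm`, `intDeltaN_ofFace`), and hypotheses `(i)`–`(iii)` are tree
  THEOREMS there (`faceForm_decay_floor`, `log_facePhi_eventually_le`, `face_gap_le_six`), so `interior_noGo`
  re-proves `Λ_n ↛ 0` on the numerator-free face of every box with `1 ≤ M ≤ 6` (`face_not_tendsto_zero`; the tree
  has the stronger `faceLambda_faceForm_tendsto_atTop`).  This is the check that the hypotheses have the right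
  polarity and are dischargeable.
* KERNEL INSTANCES (`§6`): Lemma 19's exponent bookkeeping `(M_j/n)` and `δ` at five certified rows of the lane
  record SUPKAPPA.md — the `q = 9` arg-max `(78; 18,18,20 | 23,24,26,27,29,30)`: `δ = 278`; the `q = 11` arg-max
  `(180; 54,55,56 | 58,…,72)`: `δ = 654`; and the three `η₀ = 240` slice maximisers, where SUPKAPPA §5 prints
  `δ = 856` with `(M_j/n) = (114,111,105,102,98,98)` (`q = 9`), `δ = 900` (`q = 11`), `δ = 1173` (`q = 8`) — the
  kernel values below agree with the lane engine's column digit for digit (`decide`).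
## What is NOT proved here
Lemma 20 itself (the saddle-point asymptotics of `F(h_n)` in the interior — two complex-conjugate saddles, sign
changes; hypothesis `(i)`), the `Φ`-rate (8.10) in the interior (hypothesis `(ii)`; on the face it is the tree's
`log_facePhi_eventually_le`), Lemma 19's MEANING `Λ_n ∈ ℤ + ℤζ(5) + ℤζ(7) + ⋯` with pairs (the tree has the tail
version, p248209–p249238), and any statement "for all interior directions": the inequality `(iii)` is checked per
direction by certified computation outside the kernel.  RELATION TO fam-vwp's staged `WellPoisedInteriorNoGo`
(q = 7, `Fin 4` tails, built on the vwp face files): the same reduction for ONE box; this file is the version over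
the class-`odd` objects for every `M` (different namespace, no shared declarations; when both land, the `q = 7`
statement is the `M = 2` instance up to the dictionary between the two face libraries).  Standard axioms only.
-/

noncomputable section

open Real Finset Filter Topology

namespace Summit.KontsevichZagierPeriods.Zeta5Search

namespace WellPoisedFace

open Summit.KontsevichZagierPeriods.Zeta5Search.WellPoisedFaceRate
open Literature.NumberTheory.DiophantineApproximation.ViolaZudilin (tendsto_log_lcmUpto_mul_div)

/-! ### 1. Integral directions with heads, and Lemma 19's exponents with the pairs on -/

/-- An INTEGRAL direction of the `r = 3`, `q = M + 5` box: a face direction (tails `η₄ ≤ … ≤ η_q`, `2η_q < η₀`)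
together with the three heads `η₁, η₂, η₃`, each `≤ η₄` [Zudilin2004, (8.13): `η₁ ≤ η₂ ≤ ⋯ ≤ η_q < η₀/2`].
The numerator-free face is `head = 0` (`ofFace`); the Lemma-20 regime (interior) is `1 ≤ head i`. -/
structure IntDir (M : ℕ) extends IntFaceDir M where
  /-- the heads `(η₁, η₂, η₃)` -/
  head : Fin 3 → ℕ
  /-- every head is at most the smallest tail `η₄` -/
  hhead : ∀ i, head i ≤ tail 0

/-- The PAIR factor of a slot `j ≤ r = 3` in (8.5): `(t+1)_{h_j−1} · (t+h₀−h_j+1)_{h_j−1} / ((h_j−1)!)²` with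
`h₀ = η₀n + 2`, `h_j = e·n + 1` (so `h_j − 1 = e n`, `h₀ − h_j + 1 = (η₀ − e)n + 2`).  At `e = 0` it is `1`. -/
def pairFactor (η₀ e n : ℕ) (t : ℝ) : ℝ :=
  ((∏ i ∈ Finset.range (e * n), (t + 1 + (i : ℝ))) *
      ∏ i ∈ Finset.range (e * n), (t + (((η₀ - e) * n + 2 : ℕ) : ℝ) + (i : ℝ)))
    / ((((e * n).factorial : ℕ) : ℝ) ^ 2)

/-- A pair factor with `η_j = 0` (`h_j = 1`) is identically `1`. -/
theorem pairFactor_zero (η₀ n : ℕ) : pairFactor η₀ 0 n = fun _ => 1 := by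
  funext t
  simp [pairFactor]

namespace IntDir

variable {M : ℕ} (E : IntDir M)

/-- `h_j = η_j n + 1` for the heads `j = 1, 2, 3` (integers: the argument type of `PhiQ`, `mLast`). -/
def hP (n : ℕ) (i : Fin 3) : ℤ := ((E.head i * n + 1 : ℕ) : ℤ)

/-- The unscaled Lemma-19 exponent `μ(x) = max{η₃, η₀ − 2η₄, η₀ − η₁ − x}` [Zudilin2004, p. 270: `m_j/n`]. -/
def imu (x : ℕ) : ℕ := max (max (E.head 2) (E.η₀ - 2 * E.a)) (E.η₀ - (E.head 0 + x))

/-- `μ(x) ≥ η₀ − 2η₄ > 0`. -/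
lemma imu_pos (x : ℕ) : 0 < E.imu x := by
  have h1 := E.hlo (Fin.last (M + 1)); have h2 := E.hd
  exact lt_max_iff.2 (Or.inl (lt_max_iff.2 (Or.inr (by unfold IntFaceDir.a; omega))))

/-- Zudilin's `M_j = max{h₃ − 1, h₀ − 2h₄, h₀ − h₁ − h_{3+j}}` VERBATIM at the ray, heads in place
(the tree's `mLast h₀ h₁ h₃ h₄ h_{3+j}`). -/
def intMZ (n : ℕ) (j : Fin (M + 2)) : ℤ := mLast (E.h0 n) (E.hP n 0) (E.hP n 2) (E.hT n 0) (E.hT n j)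

/-- DICTIONARY (kernel): `M_j = μ(η_{3+j}) · n` exactly. -/
theorem intMZ_eq (n : ℕ) (j : Fin (M + 2)) : E.intMZ n j = ((E.imu (E.tail j) * n : ℕ) : ℤ) := by
  have h2a : 2 * E.a ≤ E.η₀ := E.two_tail_le 0
  have hj : E.head 0 + E.tail j ≤ E.η₀ := by
    have h1 := E.hhead 0; have h2 := E.hlo j; have h3 := E.two_tail_le j; omega
  have hn0 : (0 : ℤ) ≤ n := by positivity
  unfold intMZ mLast IntFaceDir.h0 IntFaceDir.hT hP imu
  rw [Nat.cast_mul, Nat.cast_max, Nat.cast_max, Nat.cast_sub h2a, Nat.cast_sub hj,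
    max_mul_of_nonneg _ _ hn0, max_mul_of_nonneg _ _ hn0]
  unfold IntFaceDir.a at *
  refine congrArg₂ max (congrArg₂ max ?_ ?_) ?_ <;> push_cast <;> ring

/-- Hence `M_j` is the natural number `μ(η_{3+j}) · n`. -/
theorem intMZ_toNat (n : ℕ) (j : Fin (M + 2)) : (E.intMZ n j).toNat = E.imu (E.tail j) * n := by
  rw [intMZ_eq, Int.toNat_natCast]

/-- Zudilin's arithmetic factor `Φ(h_n)` [(8.9)] VERBATIM at the ray WITH THE PAIRS ON: the tree's `PhiQ` with heads
`h₁, h₂, h₃ = η₁n+1, η₂n+1, η₃n+1`, the `M + 2` tail bricks, `k_lo = h₄`, prime range `√h₀ < p ≤ M_{q−3}`. -/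
def intPhi (n : ℕ) : ℕ :=
  PhiQ (E.h0 n) (E.hP n 0) (E.hP n 1) (E.hP n 2) (E.hT n) (E.hT n 0) (E.intMZ n (Fin.last (M + 1)))

/-- Lemma 19's `D_{M₁}³ · D_{M₂} ⋯ D_{M_{q−3}}` at the ray (the cube sits on `M₁`, the exponent of the smallest
tail `η₄`). -/
def intD (n : ℕ) : ℕ :=
  Nat.lcmUpto (E.intMZ n 0).toNat ^ 3 * (∏ j : Fin M, Nat.lcmUpto (E.intMZ n j.succ.castSucc).toNat)
    * Nat.lcmUpto (E.intMZ n (Fin.last (M + 1))).toNat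

/-- `δ` as a natural number: `3μ(η₄) + Σ_mid μ(η_j) + μ(η_q)`. -/
def intDeltaN : ℕ := 3 * E.imu E.a + ∑ j : Fin M, E.imu (E.mid j) + E.imu E.d

/-- `δ = lim (1/n) log D(n)` as a real number. -/
def intDelta : ℝ := (E.intDeltaN : ℝ)

/-- Zudilin's summand `R(t)` of (8.5) at the direction: the three pair factors times the tree's tail summand
`tailR` (`(h₀ + 2t) · ∏_{j>3}` Γ-blocks, (8.7)). -/
def intR (n : ℕ) (t : ℝ) : ℝ := (∏ i : Fin 3, pairFactor E.η₀ (E.head i) n t) * tailR E.η₀ E.tail n t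

/-- `F(h_n) = ½ Σ_{t ≥ 0} R″(t)` [(8.6)] (a real number; in the interior it changes sign along subsequences). -/
def intF (n : ℕ) : ℝ := (1 / 2 : ℝ) * ∑' t : ℕ, iteratedDeriv 2 (E.intR n) (t : ℝ)

/-- THE NORMALISED FORMS `Λ_n := D(n) · Φ(h_n)⁻¹ · F(h_n)` of Lemma 19 (by Lemma 19 [PRINTED, not used]
`Λ_n ∈ ℤ + ℤζ(5) + ℤζ(7) + ⋯` for odd `q`). -/
def intLambda (n : ℕ) : ℝ := (E.intD n : ℝ) / (E.intPhi n : ℝ) * E.intF n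

/-! ### 2. Positivity and the `D`-rate `(1/n) log D(n) → δ` (PNT) -/

/-- `Φ(h_n) ≥ 1`. -/
theorem intPhi_pos (n : ℕ) : 0 < E.intPhi n := by
  unfold intPhi PhiQ
  exact Finset.prod_pos fun p hp => pow_pos (Finset.mem_filter.1 hp).2.pos _

/-- `D(n) ≥ 1`. -/
theorem intD_pos (n : ℕ) : 0 < E.intD n := by
  unfold intD
  exact Nat.mul_pos (Nat.mul_pos (pow_pos (Nat.lcmUpto_pos _) 3)
    (Finset.prod_pos fun j _ => Nat.lcmUpto_pos _)) (Nat.lcmUpto_pos _)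

/-- `D(n)` through the dictionary. -/
theorem intD_eq (n : ℕ) : E.intD n =
    Nat.lcmUpto (E.imu E.a * n) ^ 3 * (∏ j : Fin M, Nat.lcmUpto (E.imu (E.mid j) * n))
      * Nat.lcmUpto (E.imu E.d * n) := by
  simp only [intD, intMZ_toNat]
  rfl

/-- `log D(n) = 3 log D_{μ(η₄)n} + Σ_mid log D_{μ(η_j)n} + log D_{μ(η_q)n}`. -/
theorem log_intD_eq (n : ℕ) : Real.log (E.intD n) =
    3 * Real.log (Nat.lcmUpto (E.imu E.a * n)) + ∑ j : Fin M, Real.log (Nat.lcmUpto (E.imu (E.mid j) * n))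
      + Real.log (Nat.lcmUpto (E.imu E.d * n)) := by
  have hne : ∀ k, (Nat.lcmUpto k : ℝ) ≠ 0 := fun k => by exact_mod_cast (Nat.lcmUpto_pos k).ne'
  rw [E.intD_eq]
  push_cast
  rw [Real.log_mul (mul_ne_zero (pow_ne_zero _ (hne _)) (Finset.prod_ne_zero_iff.2 fun j _ => hne _)) (hne _),
    Real.log_mul (pow_ne_zero _ (hne _)) (Finset.prod_ne_zero_iff.2 fun j _ => hne _), Real.log_pow,
    Real.log_prod fun j _ => hne _]
  push_cast
  ring

/-- **`(log D(n))/n → δ`** (PNT for `ψ`, factor by factor). -/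
theorem tendsto_log_intD_div : Tendsto (fun n : ℕ => Real.log (E.intD n) / n) atTop (𝓝 E.intDelta) := by
  have ha := tendsto_log_lcmUpto_mul_div (E.imu_pos E.a)
  have hd := tendsto_log_lcmUpto_mul_div (E.imu_pos E.d)
  have hmid : Tendsto (fun n : ℕ => (∑ j : Fin M, Real.log (Nat.lcmUpto (E.imu (E.mid j) * n))) / n) atTop
      (𝓝 (∑ j : Fin M, ((E.imu (E.mid j) : ℕ) : ℝ))) := by
    simp only [Finset.sum_div]
    exact tendsto_finsetSum _ fun j _ => tendsto_log_lcmUpto_mul_div (E.imu_pos _)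
  have h := ((ha.const_mul 3).add hmid).add hd
  have hδ : E.intDelta = 3 * ((E.imu E.a : ℕ) : ℝ) + ∑ j : Fin M, ((E.imu (E.mid j) : ℕ) : ℝ)
      + ((E.imu E.d : ℕ) : ℝ) := by
    unfold intDelta intDeltaN; push_cast; ring
  rw [hδ]
  refine h.congr fun n => ?_
  rw [E.log_intD_eq]
  ring

/-- `|Λ_n| = D(n)/Φ(h_n) · |F(h_n)|`. -/
theorem abs_intLambda (n : ℕ) : |E.intLambda n| = (E.intD n : ℝ) / (E.intPhi n : ℝ) * |E.intF n| := by
  unfold intLambda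
  rw [abs_mul, abs_of_pos (div_pos (by exact_mod_cast E.intD_pos n) (by exact_mod_cast E.intPhi_pos n))]

/-! ### 3. THE REDUCTION: decay floor (i.o.) + `Φ`-rate + `C + φ < δ` ⟹ the normalised forms blow up i.o. -/

/-- Quantitative core: if `|F(h_n)| ≥ e^{−Cn}` infinitely often, `log Φ(h_n) ≤ φ₀ n` eventually and
`C + φ₀ + ε < δ`, then `|Λ_n| ≥ e^{εn}` infinitely often. -/
theorem intLambda_frequently_ge {C φ0 ε : ℝ} (hgap : C + φ0 + ε < E.intDelta)
    (hF : ∃ᶠ n : ℕ in atTop, Real.exp (-(C * n)) ≤ |E.intF n|)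
    (hΦ : ∀ᶠ n : ℕ in atTop, Real.log (E.intPhi n) ≤ φ0 * n) :
    ∃ᶠ n : ℕ in atTop, Real.exp (ε * n) ≤ |E.intLambda n| := by
  have hD := (tendsto_order.1 E.tendsto_log_intD_div).1 (C + φ0 + ε) hgap
  refine (hF.and_eventually (hD.and (hΦ.and (eventually_ge_atTop 1)))).mono ?_
  rintro n ⟨hFn, hDn, hΦn, hn1⟩
  have hnpos : (0 : ℝ) < n := by exact_mod_cast hn1
  have hDpos : (0 : ℝ) < E.intD n := by exact_mod_cast E.intD_pos n
  have hΦpos : (0 : ℝ) < E.intPhi n := by exact_mod_cast E.intPhi_pos n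
  have hFpos : 0 < |E.intF n| := lt_of_lt_of_le (Real.exp_pos _) hFn
  rw [E.abs_intLambda, ← Real.log_le_log_iff (Real.exp_pos _) (by positivity), Real.log_exp,
    Real.log_mul (div_pos hDpos hΦpos).ne' hFpos.ne', Real.log_div hDpos.ne' hΦpos.ne']
  have h1 : (C + φ0 + ε) * n < Real.log (E.intD n) := by rwa [lt_div_iff₀ hnpos] at hDn
  have h2 : -(C * n) ≤ Real.log |E.intF n| := by
    rw [← Real.log_exp (-(C * n))]
    exact Real.log_le_log (Real.exp_pos _) hFn
  have e1 : (C + φ0 + ε) * (n : ℝ) = C * n + φ0 * n + ε * n := by ring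
  rw [e1] at h1
  linarith

/-- **THE INTERIOR REDUCTION (rates form).**  `C + φ₀ < δ`, the decay floor at rate `C` infinitely often and the
`Φ`-rate `φ₀` ⟹ `|Λ_n| ≥ 1` infinitely often. -/
theorem interior_noGo_of_rates {C φ0 : ℝ} (hκ : C + φ0 < E.intDelta)
    (hF : ∃ᶠ n : ℕ in atTop, Real.exp (-(C * n)) ≤ |E.intF n|)
    (hΦ : ∀ᶠ n : ℕ in atTop, Real.log (E.intPhi n) ≤ φ0 * n) :
    ∃ᶠ n : ℕ in atTop, 1 ≤ |E.intLambda n| := by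
  have hε : 0 < (E.intDelta - C - φ0) / 2 := by linarith
  refine (E.intLambda_frequently_ge (ε := (E.intDelta - C - φ0) / 2) (by linarith) hF hΦ).mono ?_
  intro n hn
  exact le_trans (Real.one_le_exp (by positivity)) hn

/-- **THE INTERIOR NO-GO, CONDITIONAL (Zudilin's letters).**  Let `C₀` be the decay rate of `F(h_n)` in the sense
`(i)` `∀ C > C₀`, `|F(h_n)| ≥ e^{−Cn}` for infinitely many `n` ([Zudilin2004, Lemma 20]: `limsup (1/n) log|F| = −C₀`,
PRINTED), and `φ` the `Φ`-rate in the sense `(ii)` `∀ φ' > φ`, `log Φ(h_n) ≤ φ'n` eventually ((8.10), PRINTED).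
If `(iii)` `C₀ + φ < δ`, then the Lemma-19-normalised forms `Λ_n` do NOT tend to `0` (indeed `|Λ_n| ≥ 1`
infinitely often): Proposition 5 / Nesterenko's criterion cannot be fed by this direction. -/
theorem interior_noGo (C0 φ0 : ℝ) (hκ : C0 + φ0 < E.intDelta)
    (hL20 : ∀ C : ℝ, C0 < C → ∃ᶠ n : ℕ in atTop, Real.exp (-(C * n)) ≤ |E.intF n|)
    (hPhi : ∀ φ' : ℝ, φ0 < φ' → ∀ᶠ n : ℕ in atTop, Real.log (E.intPhi n) ≤ φ' * n) :
    ¬ Tendsto E.intLambda atTop (𝓝 0) := by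
  intro hT
  have hη : 0 < (E.intDelta - C0 - φ0) / 3 := by linarith
  have hfreq := E.interior_noGo_of_rates (C := C0 + (E.intDelta - C0 - φ0) / 3)
    (φ0 := φ0 + (E.intDelta - C0 - φ0) / 3) (by linarith) (hL20 _ (by linarith)) (hPhi _ (by linarith))
  have hsmall : ∀ᶠ n : ℕ in atTop, |E.intLambda n| < 1 := by
    have h := Metric.tendsto_nhds.1 hT 1 one_pos
    exact h.mono fun n hn => by simpa [Real.dist_eq] using hn
  obtain ⟨n, hn1, hn2⟩ := (hfreq.and_eventually hsmall).exists
  exact absurd hn1 (not_le.2 hn2)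

/-- The same with `(iii)` in the SCOREBOARD's letters: `C₂ := δ − φ > 0` and `κ := C₀/C₂ < 1`. -/
theorem interior_noGo_kappa (C0 φ0 : ℝ) (hC2 : 0 < E.intDelta - φ0) (hκ : C0 / (E.intDelta - φ0) < 1)
    (hL20 : ∀ C : ℝ, C0 < C → ∃ᶠ n : ℕ in atTop, Real.exp (-(C * n)) ≤ |E.intF n|)
    (hPhi : ∀ φ' : ℝ, φ0 < φ' → ∀ᶠ n : ℕ in atTop, Real.log (E.intPhi n) ≤ φ' * n) :
    ¬ Tendsto E.intLambda atTop (𝓝 0) := by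
  have h : C0 < E.intDelta - φ0 := by rwa [div_lt_one hC2] at hκ
  exact E.interior_noGo C0 φ0 (by linarith) hL20 hPhi

/-- Growth form: under `(i)`–`(iii)`, for EVERY `ε < δ − C₀ − φ`, `|Λ_n| ≥ e^{εn}` infinitely often
(`limsup (1/n) log |Λ_n| ≥ δ − C₀ − φ > 0`). -/
theorem interior_frequently_exp_le (C0 φ0 : ℝ) {ε : ℝ} (hεlt : ε < E.intDelta - C0 - φ0)
    (hL20 : ∀ C : ℝ, C0 < C → ∃ᶠ n : ℕ in atTop, Real.exp (-(C * n)) ≤ |E.intF n|)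
    (hPhi : ∀ φ' : ℝ, φ0 < φ' → ∀ᶠ n : ℕ in atTop, Real.log (E.intPhi n) ≤ φ' * n) :
    ∃ᶠ n : ℕ in atTop, Real.exp (ε * n) ≤ |E.intLambda n| := by
  have hη : 0 < (E.intDelta - C0 - φ0 - ε) / 3 := by linarith
  exact E.intLambda_frequently_ge (C := C0 + (E.intDelta - C0 - φ0 - ε) / 3)
    (φ0 := φ0 + (E.intDelta - C0 - φ0 - ε) / 3) (ε := ε) (by linarith)
    (hL20 _ (by linarith)) (hPhi _ (by linarith))

/-! ### 4. The face inside the box: `head = 0` gives back every tree object -/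

/-- A face direction as a box direction with the pairs switched off. -/
def ofFace (F : IntFaceDir M) : IntDir M where
  toIntFaceDir := F
  head := 0
  hhead := fun _ => Nat.zero_le _

variable (F : IntFaceDir M)

/-- The face part of `ofFace F` is `F` itself. -/
@[simp] theorem ofFace_toIntFaceDir : (ofFace F).toIntFaceDir = F := rfl

/-- The heads of `ofFace F` vanish. -/
@[simp] theorem ofFace_head (i : Fin 3) : (ofFace F).head i = 0 := rfl

/-- At `head = 0` every head parameter is `h_j = 1`. -/
theorem hP_ofFace (n : ℕ) (i : Fin 3) : (ofFace F).hP n i = 1 := by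
  simp [hP]

/-- `μ` at `head = 0` is the tree's face exponent `IntFaceDir.mu`. -/
theorem imu_ofFace (x : ℕ) : (ofFace F).imu x = F.mu x := by
  simp only [imu, IntFaceDir.mu, ofFace_head, ofFace_toIntFaceDir, zero_add, Nat.zero_max]

/-- `M_j` at `head = 0` is the tree's `faceMZ`. -/
theorem intMZ_ofFace (n : ℕ) (j : Fin (M + 2)) : (ofFace F).intMZ n j = F.faceMZ n j := by
  simp only [intMZ, IntFaceDir.faceMZ, hP_ofFace, ofFace_toIntFaceDir]

/-- `Φ` at `head = 0` is the tree's `facePhi`. -/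
theorem intPhi_ofFace (n : ℕ) : (ofFace F).intPhi n = F.facePhi n := by
  simp only [intPhi, IntFaceDir.facePhi, hP_ofFace, intMZ_ofFace, ofFace_toIntFaceDir]

/-- `D` at `head = 0` is the tree's `faceD`. -/
theorem intD_ofFace (n : ℕ) : (ofFace F).intD n = F.faceD n := by
  simp only [intD, IntFaceDir.faceD, intMZ_ofFace]

/-- `R` at `head = 0` is the tree's `tailR`. -/
theorem intR_ofFace (n : ℕ) : (ofFace F).intR n = tailR F.η₀ F.tail n := by
  funext t
  simp [intR, pairFactor_zero]

/-- `F` at `head = 0` is the tree's `faceForm = tailF`. -/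
theorem intF_ofFace (n : ℕ) : (ofFace F).intF n = F.faceForm n := by
  simp only [intF, intR_ofFace, IntFaceDir.faceForm, tailF]

/-- `Λ` at `head = 0` is the tree's `faceLambda faceForm`. -/
theorem intLambda_ofFace : (ofFace F).intLambda = F.faceLambda F.faceForm := by
  funext n
  simp only [intLambda, IntFaceDir.faceLambda, intD_ofFace, intPhi_ofFace, intF_ofFace]

/-- `δ` at `head = 0` is the tree's `FaceDirM.delta` of the real structure. -/
theorem intDelta_ofFace : (ofFace F).intDelta = F.real.delta := by
  have e1 : ((F.mu F.a : ℕ) : ℝ) = F.real.mOf F.real.a := F.mu_cast (F.tail_lt_η₀ 0).le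
  have e2 : ∀ j, ((F.mu (F.mid j) : ℕ) : ℝ) = F.real.mOf (F.real.mid j) := fun j => F.mu_cast (F.tail_lt_η₀ _).le
  have e3 : ((F.mu F.d : ℕ) : ℝ) = F.real.mOf F.real.d := F.mu_cast (F.tail_lt_η₀ _).le
  simp only [intDelta, intDeltaN, imu_ofFace]
  rw [FaceDirM.delta, e1.symm, e3.symm, Finset.sum_congr rfl fun j _ => (e2 j).symm]
  simp only [ofFace_toIntFaceDir]
  push_cast
  rfl

/-! ### 5. Consistency: on the face the three hypotheses are tree theorems (`1 ≤ M ≤ 6`, i.e. `6 ≤ q ≤ 11`) -/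

/-- On the numerator-free face of every box with `1 ≤ M ≤ 6` the reduction applies UNCONDITIONALLY:
`(i)` = `faceForm_decay_floor`, `(ii)` = `log_facePhi_eventually_le` (with `φ = φ⁺_ℕ`), `(iii)` = `face_gap_le_six`
(+ `phiPlusN_le`); hence `Λ_n ↛ 0` there — a COROLLARY of the tree's `faceLambda_faceForm_tendsto_atTop`,
re-derived through `interior_noGo` as a polarity check of its hypotheses. -/
theorem face_not_tendsto_zero (hM1 : 1 ≤ M) (hM : M ≤ 6) :
    ¬ Tendsto (F.faceLambda F.faceForm) atTop (𝓝 0) := by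
  rw [← intLambda_ofFace]
  refine (ofFace F).interior_noGo F.real.C0 (F.phiPlusN : ℝ) ?_ ?_ ?_
  · rw [intDelta_ofFace]
    have h1 := F.real.face_gap_le_six hM
    have h2 := F.phiPlusN_le
    have h3 := F.real.η₀_pos
    linarith
  · intro C hC
    have h := F.faceForm_decay_floor hM1 (C - F.real.C0) (by linarith)
    refine Filter.Eventually.frequently (h.mono fun n hn => ?_)
    rw [intF_ofFace]
    have e : -(F.real.C0 + (C - F.real.C0)) * (n : ℝ) = -(C * n) := by ring
    rwa [e] at hn
  · intro φ' hφ'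
    have h := F.log_facePhi_eventually_le (ε := φ' - F.phiPlusN) (by linarith)
    refine h.mono fun n hn => ?_
    rw [intPhi_ofFace]
    have e : ((F.phiPlusN : ℝ) + (φ' - F.phiPlusN)) * (n : ℝ) = φ' * n := by ring
    rwa [e] at hn

end IntDir

end WellPoisedFace

end Summit.KontsevichZagierPeriods.Zeta5Search

end
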